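import Summits.Ventures.WeilGRH.KeySectionPrinciple
import Summits.Ventures.WeilGRH.KeySectionToTest
import HarnessLib

/-!
# C-VII packaged: ONE real `(5/·)` section bounds the margin of EVERY key on the character torus

Cell `rh-explicit`, WEIL TRACK — GRH ARM (weil-grh-5, the A27/A30/A33 chain of `GRH-LIT-AS-PRINTED.md`).
The GRH-EDGE MAXIMUM PRINCIPLE of `HOME/STRUCTURE.md` (C-VII, pen weil-grh-4, GRH/STRUCTURE §16(f)–§17) says,
below the entry of the prime `5` (window `t ≤ (log 5)/2`, only `n ∈ {2, 3, 4}` visible): the supremum over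
ALL prime data `z` of the bottom `F_N(t; a, z)` of the finite Weil section is attained at the key of the real
character `(5/·)`; equivalently `ε(χ, t) ≤ log(q/5) + ε((5/·), t)` for every `χ`.  The `≤` half is what a
single-state certificate proves (weil-grh-4's G33 deposits): ONE real trigonometric section `u = Σ x_n χ_n` on
`[-b, b]` with the three sign checks `a₃(u) ≥ 0`, `a₄(u) ≥ 0`, `4a₄(u) ≤ a₂(u)` on its closed-form spikes and a
certified Rayleigh bound `keyMarkovForm a L v⋆ b u ≤ B‖u‖₂²` at the `(5/·)` datum `v⋆ = (−1, −1, +1)`.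

This file COMPOSES the two typed halves into the statement the certificate is booked against:

* `keyMargin_le_of_section_real_torus_four` — such a section forces `c ≤ B` for the margin `c` of
  `E_{a,L,v,4}` on the test functions of the window `[−(log 5)/2, (log 5)/2]`, for EVERY torus datum `v`
  (`‖v 2‖, ‖v 3‖ ≤ 1`, `v 4 = v 2²`) — the section principle `section_re_sum_le_of_real_torus_four_chi`
  (KeySectionPrinciple) read through the section → test transfer `keyMargin_le_of_isWindowFunction`
  (KeySectionToTest: mollification + Jensen contraction, `b < (log 5)/2`);
* `charMargin_le_of_section_real_torus_four` — for a Dirichlet character `χ` mod `q ≠ 1` of parity `a`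
  (any `q`, imprimitive allowed; `χ(4) = χ(2)²` and `|χ(n)| ≤ 1` are automatic): if `c‖h‖₂² ≤ Re Q_χ(h)` for
  every test `h` on that window then `c ≤ B + (log q − L)` — i.e. «margin(χ) ≤ margin-bound((5/·)) + log(q/5)»
  when the certificate is run at `L = log 5`.

Everything is proved; no definitions, no named facts, RH/GRH-free; no certificate data live here (the numbers
`x`, `B` and the three sign checks are the instance's).  [cite: Weil1952FormulesExplicites, (11) pp. 261–262;
Bombieri2000Weil, Thm 2 p. 193 and §4 Problem 2; Yoshida1992, §5 (5.13)–(5.16)]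
-/

set_option autoImplicit false

noncomputable section

open Complex Filter Set MeasureTheory
open scoped Real Topology ComplexConjugate ArithmeticFunction.vonMangoldt

namespace Summit.Ventures.WeilGRH

open Literature.NumberTheory.LFunctions
open Literature.NumberTheory.LFunctions.Yoshida1992 (modes chi chiCore mem_modes)
open Summit.RiemannHypothesis.RiemannHypothesis.Theorems.WeilFormatC

variable {b : ℝ} {q : ℕ}

/-- `((4 : ℕ) : ℝ) + 1 = 5`, the window parameter of `N = 4`. -/
private theorem cast_four_add_one : ((4 : ℕ) : ℝ) + 1 = 5 := by norm_num

/-- **C-VII, packaged (key form).**  `0 < b < (log 5)/2`; a real trigonometric section `u = Σ_{|n|≤N} x_n χ_n`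
on `[-b, b]` (`x_{−n} = conj x_n`, `x ≠ 0`) whose spikes satisfy `a₃(u) ≥ 0`, `a₄(u) ≥ 0`, `4a₄(u) ≤ a₂(u)`,
with a Rayleigh bound `keyMarkovForm a L v⋆ b u ≤ B Σ|x_n|²` at the `(5/·)` datum `v⋆` (`v⋆ 2 = v⋆ 3 = −1`,
`v⋆ 4 = 1`).  Then for EVERY torus datum `v` (`‖v 2‖ ≤ 1`, `‖v 3‖ ≤ 1`, `v 4 = (v 2)²`): any constant `c` with
`c‖h‖₂² ≤ E_{a,L,v,4}(h)` for all test functions `h` on `[−(log 5)/2, (log 5)/2]` satisfies `c ≤ B`.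
(The margin of every key below the entry of `5` is at most the `(5/·)` section's Rayleigh bound.) [folklore] -/
theorem keyMargin_le_of_section_real_torus_four (hb : 0 < b) (hb5 : b < Real.log 5 / 2) (N : ℕ)
    {x : ℤ → ℂ} (hx : ∀ n, x (-n) = conj (x n)) (hx0 : 0 < ∑ n ∈ modes N, ‖x n‖ ^ 2)
    {a : ℕ} (ha : a ≤ 1) (L : ℝ) {v vstar : ℕ → ℂ}
    (hv2 : ‖v 2‖ ≤ 1) (hv3 : ‖v 3‖ ≤ 1) (hv4 : v 4 = v 2 ^ 2)
    (hs2 : vstar 2 = -1) (hs3 : vstar 3 = -1) (hs4 : vstar 4 = 1)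
    (h3 : 0 ≤ (Λ 3 : ℝ) / Real.sqrt 3 * (2 * (weilConv (∑ m ∈ modes N, x m • chi b m)
      (weilReflect (∑ m ∈ modes N, x m • chi b m)) (Real.log 3)).re))
    (h4 : 0 ≤ (Λ 4 : ℝ) / Real.sqrt 4 * (2 * (weilConv (∑ m ∈ modes N, x m • chi b m)
      (weilReflect (∑ m ∈ modes N, x m • chi b m)) (Real.log 4)).re))
    (h24 : 4 * ((Λ 4 : ℝ) / Real.sqrt 4 * (2 * (weilConv (∑ m ∈ modes N, x m • chi b m)
        (weilReflect (∑ m ∈ modes N, x m • chi b m)) (Real.log 4)).re)) ≤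
      (Λ 2 : ℝ) / Real.sqrt 2 * (2 * (weilConv (∑ m ∈ modes N, x m • chi b m)
        (weilReflect (∑ m ∈ modes N, x m • chi b m)) (Real.log 2)).re))
    {B : ℝ} (hB : keyMarkovForm a L vstar b (∑ m ∈ modes N, x m • chi b m) ≤ B * ∑ n ∈ modes N, ‖x n‖ ^ 2)
    {c : ℝ} (hc : ∀ h : ℝ → ℂ, IsWeilTest h →
      tsupport h ⊆ Icc (-(Real.log 5 / 2)) (Real.log 5 / 2) →
      c * weilNorm2Sq h ≤ weilFinitePrimeQuadraticKey a L v 4 h) :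
    c ≤ B := by
  set u : ℝ → ℂ := ∑ m ∈ modes N, x m • chi b m with hu_def
  have hu : IsWindowFunction b u := IsWindowFunction.sum (modes N) x fun n _ ↦ isWindowFunction_chi hb n
  have hb5' : Real.exp (2 * b) ≤ 5 := by
    have h : 2 * b < Real.log 5 := by linarith
    have := Real.exp_lt_exp.2 h
    rw [Real.exp_log (by norm_num)] at this
    exact this.le
  -- the section principle at every torus datum, as a Rayleigh bound of the SAME vector for the datum `v`
  have hsec := section_re_sum_le_of_real_torus_four_chi hb hb5' N hx a L hv2 hv3 hv4 hs2 hs3 hs4 h3 h4 h24 hB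
  have hnorm : ∫ y, ‖u y‖ ^ 2 = ∑ n ∈ modes N, ‖x n‖ ^ 2 := integral_norm_sq_sum_smul_chi hb (modes N) x
  have hBv : keyMarkovForm a L v b u ≤ B * ∫ y, ‖u y‖ ^ 2 := by
    rw [hnorm, hu_def, keyMarkovForm_sum_smul_chi hb (modes N) x a L v]
    exact hsec
  have hu0 : 0 < ∫ y, ‖u y‖ ^ 2 := by rwa [hnorm]
  -- transport to the window `(log 5)/2 = log(4+1)/2` and apply the section → test transfer
  have hwin : Real.log (((4 : ℕ) : ℝ) + 1) / 2 = Real.log 5 / 2 := by rw [cast_four_add_one]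
  have hbN : b < Real.log (((4 : ℕ) : ℝ) + 1) / 2 := by rwa [hwin]
  have hBv' : keyMarkovForm a L v (Real.log (((4 : ℕ) : ℝ) + 1) / 2) u ≤ B * ∫ y, ‖u y‖ ^ 2 := by
    rwa [keyMarkovForm_window_eq_of_isWindowFunction hu hbN.le]
  have hc' : ∀ h : ℝ → ℂ, IsWeilTest h →
      tsupport h ⊆ Icc (-(Real.log (((4 : ℕ) : ℝ) + 1) / 2)) (Real.log (((4 : ℕ) : ℝ) + 1) / 2) →
      c * weilNorm2Sq h ≤ weilFinitePrimeQuadraticKey a L v 4 h := by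
    intro h hh hs
    rw [hwin] at hs
    exact hc h hh hs
  exact keyMargin_le_of_isWindowFunction hb.le hu hbN ha L v hu0 hBv' hc'

/-- **C-VII, packaged (character form).**  Same section data as above.  For a Dirichlet character `χ` mod
`q ≠ 1` of parity `a` (`charParity χ = a`; any modulus, imprimitive allowed): if `c‖h‖₂² ≤ Re Q_χ(h)` for every
test function `h` on `[−(log 5)/2, (log 5)/2]`, then `c ≤ B + (log q − L)`.  With `L = log 5` this reads
«margin of `χ` at the window `(log 5)/2` ≤ (certified `(5/·)` section bound) + `log(q/5)`» — the `≤` half of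
the GRH-edge maximum principle below the entry of the prime `5`. [folklore] -/
theorem charMargin_le_of_section_real_torus_four (hb : 0 < b) (hb5 : b < Real.log 5 / 2) (N : ℕ)
    {x : ℤ → ℂ} (hx : ∀ n, x (-n) = conj (x n)) (hx0 : 0 < ∑ n ∈ modes N, ‖x n‖ ^ 2)
    {a : ℕ} (ha : a ≤ 1) (L : ℝ) {vstar : ℕ → ℂ}
    (hs2 : vstar 2 = -1) (hs3 : vstar 3 = -1) (hs4 : vstar 4 = 1)
    (h3 : 0 ≤ (Λ 3 : ℝ) / Real.sqrt 3 * (2 * (weilConv (∑ m ∈ modes N, x m • chi b m)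
      (weilReflect (∑ m ∈ modes N, x m • chi b m)) (Real.log 3)).re))
    (h4 : 0 ≤ (Λ 4 : ℝ) / Real.sqrt 4 * (2 * (weilConv (∑ m ∈ modes N, x m • chi b m)
      (weilReflect (∑ m ∈ modes N, x m • chi b m)) (Real.log 4)).re))
    (h24 : 4 * ((Λ 4 : ℝ) / Real.sqrt 4 * (2 * (weilConv (∑ m ∈ modes N, x m • chi b m)
        (weilReflect (∑ m ∈ modes N, x m • chi b m)) (Real.log 4)).re)) ≤
      (Λ 2 : ℝ) / Real.sqrt 2 * (2 * (weilConv (∑ m ∈ modes N, x m • chi b m)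
        (weilReflect (∑ m ∈ modes N, x m • chi b m)) (Real.log 2)).re))
    {B : ℝ} (hB : keyMarkovForm a L vstar b (∑ m ∈ modes N, x m • chi b m) ≤ B * ∑ n ∈ modes N, ‖x n‖ ^ 2)
    (hq : q ≠ 1) (χ : DirichletCharacter ℂ q) (hχa : charParity χ = a)
    {c : ℝ} (hc : ∀ h : ℝ → ℂ, IsWeilTest h →
      tsupport h ⊆ Icc (-(Real.log 5 / 2)) (Real.log 5 / 2) → c * weilNorm2Sq h ≤ (weilQuadraticChar χ h).re) :
    c ≤ B + (Real.log q - L) := by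
  obtain ⟨hv2, hv3, hv4⟩ := torus_data_of_mulChar χ
  have h5 : Real.exp (2 * (Real.log 5 / 2)) ≤ ((4 : ℕ) : ℝ) + 1 := by
    rw [mul_div_cancel₀ _ two_ne_zero, Real.exp_log (by norm_num), cast_four_add_one]
  -- Re Q_χ(h) = E_{a, log q, χ, 4}(h) = E_{a, L, χ, 4}(h) + (log q − L)‖h‖₂² on the window
  have hc' : ∀ h : ℝ → ℂ, IsWeilTest h →
      tsupport h ⊆ Icc (-(Real.log 5 / 2)) (Real.log 5 / 2) →
      (c - (Real.log q - L)) * weilNorm2Sq h ≤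
        weilFinitePrimeQuadraticKey a L (fun n ↦ χ (n : ZMod q)) 4 h := by
    intro h hh hs
    have h1 := hc h hh hs
    rw [re_weilQuadraticChar_eq_keyMarkovForm hq χ hh hs, hχa,
      keyMarkovForm_eq_weilFinitePrimeQuadraticKey hh hs h5 ha (Real.log q) (fun n ↦ χ (n : ZMod q)),
      weilFinitePrimeQuadraticKey_eq_add_norm hh a L (Real.log q) _ 4] at h1
    rw [sub_mul]
    linarith
  have key := keyMargin_le_of_section_real_torus_four hb hb5 N hx hx0 ha L hv2 hv3 hv4 hs2 hs3 hs4 h3 h4 h24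
    hB hc'
  linarith

end Summit.Ventures.WeilGRH

end
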